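import Literature.NumberTheory.LFunctions.MoebiusAutomaticOfMauduitRivat
import HarnessLib

/-!
# Müllner's Thm. 4.4 (the matrix Mauduit–Rivat estimate) as the residual content of
# `mullner_moebius_automatic`

NumberTheory/LFunctions. Fact decomposition (librarian, mode `fact-decompose`, 2026-08-16) of the
XL named fact `Literature.NumberTheory.LFunctions.mullner_moebius_automatic`
(`MoebiusAutomatic.lean`; C. Müllner, Duke Math. J. 166 (2017), Thm. 1.2, case `ξ = a`: automatic
sequences are orthogonal to `μ`).

The printed proof: Thm. 1.2 ⇐ Prop. 3.3 (reduction to zero-stable roots of the final components of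
a power automaton, Prop. 2.25) ⇐ Prop. 3.2 (§4.3: the `D_ℓ`-part by Lemma 4.11, the other
representations by **Thm. 4.4** with Lemma 4.10 and Thm. 4.5). Everything except Thm. 4.4 is PROVED
in the tree (`mullner_moebius_automatic_of_operatorMauduitRivat`,
`MoebiusAutomaticOfMauduitRivat.lean`, over the notion `OperatorMauduitRivat k` — Thm. 4.4 in
operator form with the growth condition of Mauduit–Rivat 2015, Remark 1 — and its many
`MoebiusAutomatic*.lean` predecessors), so the fact splits into the single consequence child:

* `mullner2017_thm44` (CHILD, named fact) — `∀ k ≥ 2, OperatorMauduitRivat k`;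
* `mullner_moebius_automatic_holds_of` (ASSEMBLY, proved).

The child does not restate the parent (it is an exponential-sum estimate for unitary
representations of digital functions with the carry and Fourier properties, uniform in `θ`). Its
printed proof is Mauduit–Rivat, J. Eur. Math. Soc. 17 (2015), Thm. 2 (for matrices: Müllner §4.1):
Vaughan/type I–II decomposition, the carry property for type I sums (§5), van der Corput and the
Fourier `L²`/`L^∞` control of the middle digits for type II sums (§6) — the object of the proof files
`MauduitRivat*.lean` of this directory (second seat of the parent, 2026-08-15/16).

## References
* C. Müllner, *Automatic sequences fulfill the Sarnak conjecture*, Duke Math. J. 166 (2017)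
  3219–3290 = arXiv:1602.03042: Thm. 1.2, Prop. 3.2, Prop. 3.3, Thm. 4.4 (p. 19), §4.3.
  [Mullner2017]
* C. Mauduit, J. Rivat, J. Eur. Math. Soc. 17 (2015) 2595–2642, Thm. 1, Thm. 2, Remark 1.
  [MauduitRivat2015]
-/

noncomputable section

namespace Literature.NumberTheory.LFunctions

/-- NAMED FACT (split child of `mullner_moebius_automatic`) — **Müllner 2017, Thm. 4.4 (matrix
Mauduit–Rivat estimate), for every base `k ≥ 2`**, in the operator form with growth condition
`OperatorMauduitRivat k` of `MoebiusAutomaticOfMauduitRivat.lean`. Printed (p. 19): for `γ`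
non-decreasing with `γ(λ) → ∞`, `f : ℕ → U_d` with the carry property (Def. 4.1) and
`f ∈ F_{γ,c}` (the Fourier property, Def. 4.2) for some `c ≥ 10`,
`‖∑_{n≤x} μ(n) f(n) e(θn)‖ ≪ c₁(k) (log x)^{9/4 + max(ω(k),2)/4} x k^{-ηγ(2⌊log x/(80 log k)⌋)/20}`
uniformly in `θ ∈ ℝ` — `o(x)` under Mauduit–Rivat's growth condition `γ(λ)/log λ → ∞` (J. Eur.
Math. Soc. 17 (2015), Remark 1, (9)), which `OperatorMauduitRivat` carries as a hypothesis.
[cite: Mullner2017, Thm. 4.4] [cite: MauduitRivat2015, Thm. 2 and Remark 1] -/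
def mullner2017_thm44 : Prop :=
  ∀ k : ℕ, 2 ≤ k → OperatorMauduitRivat k

/-- ASSEMBLY of the split of `mullner_moebius_automatic` (PROVED): **Thm. 1.2 (case `ξ = a`) from
Thm. 4.4** via Prop. 3.3, Prop. 3.2 and §4.3, all proved
(`mullner_moebius_automatic_of_operatorMauduitRivat`). [cite: Mullner2017, Thm. 1.2 via Prop. 3.3, Prop. 3.2, Thm. 4.4] -/
theorem mullner_moebius_automatic_holds_of (h : mullner2017_thm44) : mullner_moebius_automatic :=
  mullner_moebius_automatic_of_operatorMauduitRivat h

end Literature.NumberTheory.LFunctions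

end
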